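import Summits.AtomisticToContinuum.Crystallization.Theorems.FrustratedLawDichotomyPairPotentialDoor
import Summits.AtomisticToContinuum.Crystallization.Theorems.FrustratedLawDichotomyExemptSplit

/-!
# FrustratedLawDichotomy · crux `AperiodicFrustratedLawGap` (stmt-AtomisticToContinuum-27623) — the discharging / motif door WITH THE
# EXEMPTION INDICATOR (decomp-a2c, prover hand 2, structural share, generation 15; generic, radius-free)

Hand-2 g12's door (`…PairPotentialDoor`: `PairRuleMotifCertificate ⟹ PairRuleCertificate ⟹ T′♭ / FRG♭`) prices EVERY `7/10`-legal motif; hand-2 g14's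
exemption door (`…ExemptDoor` / `…ExemptRemoval` / `…ExemptLocOpt` / `…ExemptSplit`: `DeepAbsent M Ex ∧ FRG♭_X(…, Ex) ⟹` crux) makes every
deep-absent site predicate `Ex` FREE.  This file joins the two (repair-census item 3 of hand-2 g14, «exemption indicator in the pair-rule / motif
certificate framework»): the per-site level gets a fourth coefficient on the indicator of `Ex`, and the motif certificate reads a MOTIF-LEVEL predicate
`ExM` which TRANSFERS to `Ex` on the cluster (`MotifTransfer ϱ ExM Ex`: if `ExM` holds at the centre of the radius-`ϱ` motif of a site then `Ex` holds at
the site) — exactly as capped goodness transfers by `goodAt_of_motif`: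

* §1 `PairRuleCertificateX η₀ η₁ W A c₀ c₁ c₂ c₃ R′ ρ B F Ex` (level `c₀ + c₁𝟙[η₀-good] + c₂𝟙[η₁-good] + c₃𝟙[Ex]`), kernel `sum_le_of_pairRuleCertificateX`,
  instances ★ `schurTopologicalPricingX_of_ruleX` (Topt♭_X of `…ExemptSplit`, `c = (eUp + κ_T, −C_T, −κ_T, −D_T)`) and ★ `schurRangeGapX_of_ruleX`
  (FRG♭_X of `…ExemptRemoval`: `c = (e₁, −C, 0, −C)` gives `FRG♭_X(e₁, 2C, Ex)` since `#good + #Ex ≤ 2·#{good ∨ Ex}`);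
* §2 `MotifTransfer ϱ ExM Ex` (+ `.mono`, `.of_imp`, `motifTransfer_self_of_local`-type helpers), `PairRuleMotifCertificateX … D ϱ F ExM`
  (capped indicators + `𝟙[ExM]` on motifs confined to radius `ϱ`), the motif lemma `motif_transferWX` and ★★ THE DOOR `pairRuleCertificateX_of_motifX`
  (`W` vanishing from `R` on, `ϱ ≥ max (R, R′ + ρ, ρ, R′, 13/10·D + 1, 0)`, `c₁, c₂, c₃ ≤ 0`, `MotifTransfer ϱ ExM Ex`);
* §3 at the node of record (`W₄₅ = effPot w₄₅ ω₄ (3/400)`, vanishing from `9/2`): `schurRangeGapX_fourHalf_of_motifX`, `schurTopologicalPricingX_fourHalf_of_motifX`,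
  and ★★ `aperiodicFrustratedLawGap_of_schurMotifX_fourHalf` : `MuEquilibriumDoor ∧ SF₄₅ ∧ UP(−0.7175) ∧ DeepAbsent M Ex ∧ MotifTransfer ϱ ExM Ex ∧
  [rule F: range R′, locality ρ, bound B] ∧ X-motif certificate (level (e₁, −C, 0, −C), e₁ > −0.7175) ⟹` crux.

Instances of `MotifTransfer` for the optimality line's exemptions (`ExchangeUnstableLoc`, the one-atom move with dipole slack) are in the sequel
`…PairPotentialDoorXMoves`.  All `[folklore]` bookkeeping on landed lemmas; 0 sorry.
-/

noncomputable section

namespace Summit.AtomisticToContinuum.Crystallization.Theorems.FrustratedLawDichotomyPairPotentialDoorX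

open scoped BigOperators Classical
open Metric
open Literature.MathematicalPhysics.StatisticalMechanics (interactionEnergy lennardJones)
open Summit.AtomisticToContinuum.Crystallization.Theorems.ChargedEnergyGapNegative (E3 eStar)
open Summit.AtomisticToContinuum.Crystallization.Theorems.FrustratedLawDichotomyRangeCut
open Summit.AtomisticToContinuum.Crystallization.Theorems.FrustratedLawDichotomyLocalPricing (goodCount_eq_sum)
open Summit.AtomisticToContinuum.Crystallization.Theorems.FrustratedLawDichotomyLocalDischargingRule
open Summit.AtomisticToContinuum.Crystallization.Theorems.FrustratedLawDichotomyMotifLemmas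
open Summit.AtomisticToContinuum.Crystallization.Theorems.FrustratedLawDichotomySchurCut
open Summit.AtomisticToContinuum.Crystallization.Theorems.FrustratedLawDichotomyPairPotentialDoor
open Summit.AtomisticToContinuum.Crystallization.Theorems.FrustratedLawDichotomyExemptDoor (SitePred DeepAbsent)
open Summit.AtomisticToContinuum.Crystallization.Theorems.FrustratedLawDichotomyExemptRemoval
  (SchurRangeGapX aperiodicFrustratedLawGap_of_schurCutX_fourHalf)
open Summit.AtomisticToContinuum.Crystallization.Theorems.FrustratedLawDichotomyExemptSplit (SchurTopologicalPricingX counts_le)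

/-! ## §1. The rule certificate with an exemption indicator -/

/-- **`PairRuleCertificateX η₀ η₁ W A c₀ c₁ c₂ c₃ R′ ρ B F Ex`** — the rule `F` has range `R′`, locality radius `ρ`, bound `B`, and at EVERY site of
EVERY injective `7/10`-separated cluster `c₀ + c₁·𝟙[η₀-good] + c₂·𝟙[η₁-good] + c₃·𝟙[Ex] ≤ (Σ_j W(r_ij) − W 0)/2 − A + netInflow_i`. -/
def PairRuleCertificateX (η₀ η₁ : ℝ) (W : ℝ → ℝ) (A c₀ c₁ c₂ c₃ R' ρ B : ℝ) (F : TransferRule) (Ex : SitePred) : Prop :=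
  HasRange R' F ∧ IsLocal ρ F ∧ IsBounded B F ∧
    ∀ (N : ℕ) (y : Fin N → E3), Function.Injective y → Sep y → ∀ i : Fin N,
      c₀ + c₁ * (if GoodAt η₀ y i then (1 : ℝ) else 0) + c₂ * (if GoodAt η₁ y i then (1 : ℝ) else 0) +
          c₃ * (if Ex N y i then (1 : ℝ) else 0) ≤
        (∑ j, W (dist (y i) (y j)) - W 0) / 2 - A + netInflow F N y i

/-- The exempt count as a sum of indicators. [folklore] -/
theorem exCount_eq_sum (Ex : SitePred) {N : ℕ} (y : Fin N → E3) :
    (Nat.card {i : Fin N // Ex N y i} : ℝ) = ∑ i, (if Ex N y i then (1 : ℝ) else 0) := by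
  rw [Finset.sum_boole, Nat.card_eq_fintype_card, Fintype.card_subtype]

/-- **Kernel**: an X-rule certificate gives `c₀·N + c₁·g₀ + c₂·g₁ + c₃·#Ex ≤ U_W − A·N` on every Sep cluster. [folklore] -/
theorem sum_le_of_pairRuleCertificateX {η₀ η₁ : ℝ} {W : ℝ → ℝ} {A c₀ c₁ c₂ c₃ R' ρ B : ℝ} {F : TransferRule} {Ex : SitePred}
    (h : PairRuleCertificateX η₀ η₁ W A c₀ c₁ c₂ c₃ R' ρ B F Ex) (N : ℕ) (y : Fin N → E3) (hy : Function.Injective y) (hsep : Sep y) :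
    c₀ * N + c₁ * goodCount η₀ y + c₂ * goodCount η₁ y + c₃ * (Nat.card {i : Fin N // Ex N y i} : ℝ) ≤
      interactionEnergy W y - A * N := by
  have hs := sum_le_interactionEnergy_of_transfers W A y (F N y) (fun i => h.2.2.2 N y hy hsep i)
  simp only [Finset.sum_add_distrib, Finset.sum_const, Finset.card_univ, Fintype.card_fin, nsmul_eq_mul, ← Finset.mul_sum] at hs
  rw [← goodCount_eq_sum, ← goodCount_eq_sum, ← exCount_eq_sum] at hs
  linarith

/-- An X-certificate with `c₃ = 0` is an ordinary certificate and conversely (the exemption column is idle). [folklore] -/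
theorem pairRuleCertificateX_zero_iff {η₀ η₁ : ℝ} {W : ℝ → ℝ} {A c₀ c₁ c₂ R' ρ B : ℝ} {F : TransferRule} (Ex : SitePred) :
    PairRuleCertificateX η₀ η₁ W A c₀ c₁ c₂ 0 R' ρ B F Ex ↔ PairRuleCertificate η₀ η₁ W A c₀ c₁ c₂ R' ρ B F := by
  simp only [PairRuleCertificateX, PairRuleCertificate, zero_mul, add_zero]

/-- ★ **`Topt♭_X ⟸ X-rule certificate`** with `W = effPot w ω A`, `c = (eUp + κ_T, −C_T, −κ_T, −D_T)`. [folklore] -/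
theorem schurTopologicalPricingX_of_ruleX {η₀ η₁ : ℝ} {w ω : ℝ → ℝ} {A eUp κT CT DT R' ρ B : ℝ} {F : TransferRule} {Ex : SitePred}
    (h : PairRuleCertificateX η₀ η₁ (effPot w ω A) A (eUp + κT) (-CT) (-κT) (-DT) R' ρ B F Ex) :
    SchurTopologicalPricingX η₀ η₁ w ω A eUp κT CT DT Ex := by
  intro N y hy hsep
  have := sum_le_of_pairRuleCertificateX h N y hy hsep
  linarith

/-- ★ **`FRG♭_X ⟸ X-rule certificate`** with `c = (e₁, −C, 0, −C)` (`C ≥ 0`): `SchurRangeGapX w ω A e₁ (2C) Ex` — the certificate may credit `C` for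
goodness AND `C` for the exemption; `#good + #Ex ≤ 2·#{good ∨ Ex}`. [folklore] -/
theorem schurRangeGapX_of_ruleX {η₁ : ℝ} {w ω : ℝ → ℝ} {A e₁ C R' ρ B : ℝ} {F : TransferRule} {Ex : SitePred} (hC : 0 ≤ C)
    (h : PairRuleCertificateX (1 / 20) η₁ (effPot w ω A) A e₁ (-C) 0 (-C) R' ρ B F Ex) :
    SchurRangeGapX w ω A e₁ (2 * C) Ex := by
  intro N y hy hsep
  have h1 := sum_le_of_pairRuleCertificateX h N y hy hsep
  obtain ⟨hg, he⟩ := counts_le (η₀ := 1 / 20) (Ex := Ex) y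
  have h2 : C * (goodCount (1 / 20) y : ℝ) ≤ C * Nat.card {i : Fin N // GoodAt (1 / 20) y i ∨ Ex N y i} :=
    mul_le_mul_of_nonneg_left hg hC
  have h3 : C * (Nat.card {i : Fin N // Ex N y i} : ℝ) ≤ C * Nat.card {i : Fin N // GoodAt (1 / 20) y i ∨ Ex N y i} :=
    mul_le_mul_of_nonneg_left he hC
  linarith

/-! ## §2. Motif-level exemptions, the X-motif certificate and THE DOOR -/

/-- **`MotifTransfer ϱ ExM Ex`**: whenever `z = y ∘ φ` (`φ` injective) is a sub-cluster of an injective `7/10`-separated cluster `y` containing every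
atom of `y` within `ϱ` of `y (φ c)`, the MOTIF-LEVEL predicate `ExM` at the centre `c` of `z` implies `Ex` at the site `φ c` of `y`. -/
def MotifTransfer (ϱ : ℝ) (ExM Ex : SitePred) : Prop :=
  ∀ (N M : ℕ) (y : Fin N → E3) (φ : Fin M → Fin N) (c : Fin M), Function.Injective y → Sep y → Function.Injective φ →
    (∀ k : Fin N, dist (y k) (y (φ c)) ≤ ϱ → k ∈ Set.range φ) → ExM M (y ∘ φ) c → Ex N y (φ c)

/-- `MotifTransfer` is monotone in the motif radius. [folklore] -/
theorem MotifTransfer.mono {ϱ ϱ' : ℝ} {ExM Ex : SitePred} (h : MotifTransfer ϱ ExM Ex) (hle : ϱ ≤ ϱ') : MotifTransfer ϱ' ExM Ex :=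
  fun N M y φ c hy hsep hφ hS hM => h N M y φ c hy hsep hφ (fun k hk => hS k (hk.trans hle)) hM

/-- `MotifTransfer` composes with implications on both sides. [folklore] -/
theorem MotifTransfer.of_imp {ϱ : ℝ} {ExM ExM' Ex Ex' : SitePred} (h : MotifTransfer ϱ ExM Ex)
    (hM : ∀ (M : ℕ) (z : Fin M → E3) (c : Fin M), ExM' M z c → ExM M z c)
    (hE : ∀ (N : ℕ) (y : Fin N → E3) (i : Fin N), Ex N y i → Ex' N y i) : MotifTransfer ϱ ExM' Ex' :=
  fun N M y φ c hy hsep hφ hS hM' => hE N y (φ c) (h N M y φ c hy hsep hφ hS (hM M (y ∘ φ) c hM'))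

/-- The trivial exemption never fires. [folklore] -/
theorem motifTransfer_bot (ϱ : ℝ) (Ex : SitePred) : MotifTransfer ϱ (fun _ _ _ => False) Ex :=
  fun _ _ _ _ _ _ _ _ _ h => h.elim

/-- **`PairRuleMotifCertificateX η₀ η₁ W A c₀ c₁ c₂ c₃ D ϱ F ExM`** — the PER-MOTIF inequality with CAPPED indicators and the motif-level exemption:
for every injective `7/10`-separated motif `z` (all atoms within `ϱ` of the centre `c`),
`c₀ + c₁·𝟙[GoodAtScale η₀ D] + c₂·𝟙[GoodAtScale η₁ D] + c₃·𝟙[ExM] ≤ (Σ_a W(dist (z c) (z a)) − W 0)/2 − A + netInflow F M z c`. -/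
def PairRuleMotifCertificateX (η₀ η₁ : ℝ) (W : ℝ → ℝ) (A c₀ c₁ c₂ c₃ D ϱ : ℝ) (F : TransferRule) (ExM : SitePred) : Prop :=
  ∀ (M : ℕ) (z : Fin M → E3), Function.Injective z → Sep z → ∀ c : Fin M, (∀ a : Fin M, dist (z a) (z c) ≤ ϱ) →
    c₀ + c₁ * (if GoodAtScale η₀ D z c then (1 : ℝ) else 0) + c₂ * (if GoodAtScale η₁ D z c then (1 : ℝ) else 0) +
        c₃ * (if ExM M z c then (1 : ℝ) else 0) ≤
      (∑ a, W (dist (z c) (z a)) - W 0) / 2 - A + netInflow F M z c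

/-- An X-motif certificate with `c₃ = 0` is an ordinary motif certificate and conversely. [folklore] -/
theorem pairRuleMotifCertificateX_zero_iff {η₀ η₁ : ℝ} {W : ℝ → ℝ} {A c₀ c₁ c₂ D ϱ : ℝ} {F : TransferRule} (ExM : SitePred) :
    PairRuleMotifCertificateX η₀ η₁ W A c₀ c₁ c₂ 0 D ϱ F ExM ↔ PairRuleMotifCertificate η₀ η₁ W A c₀ c₁ c₂ D ϱ F := by
  simp only [PairRuleMotifCertificateX, PairRuleMotifCertificate, zero_mul, add_zero]

/-- A motif certificate WITHOUT exemptions is an X-motif certificate for ANY `ExM` when `c₃ ≤ 0` (the exemption only helps). [folklore] -/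
theorem pairRuleMotifCertificateX_of_cert {η₀ η₁ : ℝ} {W : ℝ → ℝ} {A c₀ c₁ c₂ c₃ D ϱ : ℝ} {F : TransferRule} (ExM : SitePred) (hc₃ : c₃ ≤ 0)
    (h : PairRuleMotifCertificate η₀ η₁ W A c₀ c₁ c₂ D ϱ F) : PairRuleMotifCertificateX η₀ η₁ W A c₀ c₁ c₂ c₃ D ϱ F ExM := by
  intro M z hz hsep c hconf
  have hm := h M z hz hsep c hconf
  have h0 : c₃ * (if ExM M z c then (1 : ℝ) else 0) ≤ 0 := mul_nonpos_of_nonpos_of_nonneg hc₃ (by split_ifs <;> norm_num)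
  linarith

/-- **THE MOTIF LEMMA with exemptions**: at every site `i` of a cluster the motif `S = {j : dist (y j) (y i) ≤ ϱ}` carries the same right-hand side,
capped goodness of its centre implies goodness in the cluster, and `ExM` at its centre implies `Ex` at `i` (`MotifTransfer`). [folklore] -/
theorem motif_transferWX {W : ℝ → ℝ} {R R' ρ ϱ A D : ℝ} {F : TransferRule} {ExM Ex : SitePred} (hW : ∀ r, R ≤ r → W r = 0)
    (hF₁ : HasRange R' F) (hF₂ : IsLocal ρ F)
    (h0 : 0 ≤ ϱ) (hR : R ≤ ϱ) (hRρ : R' + ρ ≤ ϱ) (hρ : ρ ≤ ϱ) (hR' : R' ≤ ϱ) (hD : 13 / 10 * D + 1 ≤ ϱ) (hEx : MotifTransfer ϱ ExM Ex)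
    {N : ℕ} {y : Fin N → E3} (hy : Function.Injective y) (hsep : Sep y) (i : Fin N) :
    ∃ (M : ℕ) (z : Fin M → E3) (c : Fin M), Function.Injective z ∧ Sep z ∧ (∀ a : Fin M, dist (z a) (z c) ≤ ϱ) ∧
      (∑ a, W (dist (z c) (z a)) - W 0) / 2 - A + netInflow F M z c =
        (∑ j, W (dist (y i) (y j)) - W 0) / 2 - A + netInflow F N y i ∧
      (∀ η : ℝ, GoodAtScale η D z c → GoodAt η y i) ∧ (ExM M z c → Ex N y i) := by
  set S : Finset (Fin N) := Finset.univ.filter (fun j => dist (y j) (y i) ≤ ϱ) with hS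
  have hSdef0 : ∀ j, j ∈ S ↔ dist (y j) (y i) ≤ ϱ := fun j => by simp [hS]
  have hiS : i ∈ S := (hSdef0 i).2 (by rw [dist_self]; exact h0)
  let φ : Fin S.card ↪o Fin N := S.orderEmbOfFin rfl
  have hφ : Set.range φ = ↑S := Finset.range_orderEmbOfFin S rfl
  have hiφ : i ∈ Set.range φ := by rw [hφ]; exact hiS
  obtain ⟨c, hc⟩ := hiφ
  have hSdef : ∀ j, j ∈ S ↔ dist (y j) (y (φ c)) ≤ ϱ := by rw [hc]; exact hSdef0
  have hSr : ∀ k : Fin N, dist (y k) (y (φ c)) ≤ ϱ → k ∈ Set.range φ := fun k hk => by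
    rw [hφ]; exact (hSdef k).2 hk
  have hφinj : Function.Injective φ := φ.injective
  refine ⟨S.card, y ∘ φ, c, hy.comp hφinj, fun a b hab => hsep (φ a) (φ b) (hφinj.ne hab), fun a => ?_, ?_, fun η hη => ?_, fun hM => ?_⟩
  · have ha : φ a ∈ S := by
      have h : φ a ∈ Set.range φ := ⟨a, rfl⟩
      rw [hφ] at h
      exact h
    exact (hSdef (φ a)).1 ha
  · have e1 : ∑ a, W (dist ((y ∘ φ) c) ((y ∘ φ) a)) = ∑ j, W (dist (y (φ c)) (y j)) := pairSum_motif hW hR φ hφ hSdef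
    have e3 : netInflow F S.card (y ∘ φ) c = netInflow F N y (φ c) := netInflow_motif hF₁ hF₂ hRρ hρ hR' φ hφ hSdef
    rw [e1, e3, hc]
  · rw [← hc]; exact goodAt_of_motif hSr hD hη
  · rw [← hc]; exact hEx N S.card y φ c hy hsep hφinj hSr hM

/-- ★★ **THE DOOR with exemptions**: `W` vanishing from `R` on, a rule of range `R′`, locality `ρ`, bound `B`, motif radius
`ϱ ≥ max (R, R′ + ρ, ρ, R′, 13/10·D + 1, 0)`, NONPOSITIVE coefficients `c₁, c₂, c₃ ≤ 0` and `MotifTransfer ϱ ExM Ex`: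
X-motif certificate ⟹ X-rule certificate. [folklore] -/
theorem pairRuleCertificateX_of_motifX {η₀ η₁ : ℝ} {W : ℝ → ℝ} {R A c₀ c₁ c₂ c₃ D ϱ R' ρ B : ℝ} {F : TransferRule} {ExM Ex : SitePred}
    (hW : ∀ r, R ≤ r → W r = 0) (hF₁ : HasRange R' F) (hF₂ : IsLocal ρ F) (hF₃ : IsBounded B F)
    (h0 : 0 ≤ ϱ) (hR : R ≤ ϱ) (hRρ : R' + ρ ≤ ϱ) (hρ : ρ ≤ ϱ) (hR' : R' ≤ ϱ) (hD : 13 / 10 * D + 1 ≤ ϱ)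
    (hEx : MotifTransfer ϱ ExM Ex) (hc₁ : c₁ ≤ 0) (hc₂ : c₂ ≤ 0) (hc₃ : c₃ ≤ 0)
    (h : PairRuleMotifCertificateX η₀ η₁ W A c₀ c₁ c₂ c₃ D ϱ F ExM) :
    PairRuleCertificateX η₀ η₁ W A c₀ c₁ c₂ c₃ R' ρ B F Ex := by
  refine ⟨hF₁, hF₂, hF₃, fun N y hy hsep i => ?_⟩
  obtain ⟨M, z, c, hz, hzsep, hconf, hrhs, hgood, hex⟩ :=
    motif_transferWX (A := A) hW hF₁ hF₂ h0 hR hRρ hρ hR' hD hEx hy hsep i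
  have hm := h M z hz hzsep c hconf
  rw [hrhs] at hm
  have e0 := mul_le_mul_of_nonpos_left (ite_le_ite_of_imp (hgood η₀)) hc₁
  have e1 := mul_le_mul_of_nonpos_left (ite_le_ite_of_imp (hgood η₁)) hc₂
  have e2 := mul_le_mul_of_nonpos_left (ite_le_ite_of_imp hex) hc₃
  linarith

/-! ## §3. The node of record (`W₄₅`, range `9/2`) through the X-door, and the crux BY NAME -/

/-- ★ **`FRG♭_X(e₁, 2C, Ex) ⟸ X-motif certificate`** at `(w₄₅, ω₄, 3/400)`: rule of range `R′`, locality `ρ`, bound `B`, radius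
`ϱ ≥ max (9/2, R′ + ρ, ρ, R′, 13/10·D + 1)`, `0 ≤ C`, `MotifTransfer ϱ ExM Ex`, level `(e₁, −C, 0, −C)`. [folklore chaining] -/
theorem schurRangeGapX_fourHalf_of_motifX {η₁ e₁ C D ϱ R' ρ B : ℝ} {F : TransferRule} {ExM Ex : SitePred}
    (hF₁ : HasRange R' F) (hF₂ : IsLocal ρ F) (hF₃ : IsBounded B F)
    (hR : 9 / 2 ≤ ϱ) (hRρ : R' + ρ ≤ ϱ) (hρ : ρ ≤ ϱ) (hR' : R' ≤ ϱ) (hD : 13 / 10 * D + 1 ≤ ϱ) (hC : 0 ≤ C)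
    (hEx : MotifTransfer ϱ ExM Ex)
    (h : PairRuleMotifCertificateX (1 / 20) η₁ (effPot w₄₅ ω₄ (3 / 400)) (3 / 400) e₁ (-C) 0 (-C) D ϱ F ExM) :
    SchurRangeGapX w₄₅ ω₄ (3 / 400) e₁ (2 * C) Ex :=
  schurRangeGapX_of_ruleX hC
    (pairRuleCertificateX_of_motifX (fun r hr => effPot_fourHalf_eq_zero _ hr) hF₁ hF₂ hF₃ (by linarith) hR hRρ hρ hR' hD hEx
      (by linarith) le_rfl (by linarith) h)

/-- ★ **`Topt♭_X(κ_T, C_T, D_T; Ex) ⟸ X-motif certificate`** at `(w₄₅, ω₄, 3/400)` (`0 ≤ κ_T, C_T, D_T`; feeds `…ExemptSplit.aperiodicFrustratedLawGap_of_splitX_fourHalf`).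
[folklore chaining] -/
theorem schurTopologicalPricingX_fourHalf_of_motifX {η₀ η₁ eUp κT CT DT D ϱ R' ρ B : ℝ} {F : TransferRule} {ExM Ex : SitePred}
    (hF₁ : HasRange R' F) (hF₂ : IsLocal ρ F) (hF₃ : IsBounded B F)
    (hR : 9 / 2 ≤ ϱ) (hRρ : R' + ρ ≤ ϱ) (hρ : ρ ≤ ϱ) (hR' : R' ≤ ϱ) (hD : 13 / 10 * D + 1 ≤ ϱ)
    (hκ : 0 ≤ κT) (hC : 0 ≤ CT) (hDT : 0 ≤ DT) (hEx : MotifTransfer ϱ ExM Ex)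
    (h : PairRuleMotifCertificateX η₀ η₁ (effPot w₄₅ ω₄ (3 / 400)) (3 / 400) (eUp + κT) (-CT) (-κT) (-DT) D ϱ F ExM) :
    SchurTopologicalPricingX η₀ η₁ w₄₅ ω₄ (3 / 400) eUp κT CT DT Ex :=
  schurTopologicalPricingX_of_ruleX
    (pairRuleCertificateX_of_motifX (fun r hr => effPot_fourHalf_eq_zero _ hr) hF₁ hF₂ hF₃ (by linarith) hR hRρ hρ hR' hD hEx
      (by linarith) (by linarith) (by linarith) h)

/-- ★★ **The crux from the X-door at the node of record**: `MuEquilibriumDoor ∧ SF₄₅ ∧ UP(−0.7175) ∧ DeepAbsent M Ex ∧ MotifTransfer ϱ ExM Ex ∧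
[rule F: range R′, locality ρ, bound B] ∧ X-motif certificate at W₄₅ (level (e₁, −C, 0, −C), capped scale D, radius ϱ ≥ max (9/2, R′ + ρ, ρ, R′, 13/10·D + 1),
C ≥ 0, e₁ > −0.7175) ⟹ AperiodicFrustratedLawGap` — every motif whose centre is capped-good OR motif-exempt may take the credit `C`. [folklore chaining] -/
theorem aperiodicFrustratedLawGap_of_schurMotifX_fourHalf {η₁ e₁ C D ϱ R' ρ B Mdepth : ℝ} {F : TransferRule} {ExM Ex : SitePred}
    (hDoor : Summit.AtomisticToContinuum.Crystallization.Theses.GrainCoreNetworkSplit.MuEquilibriumDoor)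
    (hF : SF₄₅) (hU : PeriodicEnergyCeiling (-(7175 / 10000))) (hExDeep : DeepAbsent Mdepth Ex) (hEx : MotifTransfer ϱ ExM Ex)
    (hF₁ : HasRange R' F) (hF₂ : IsLocal ρ F) (hF₃ : IsBounded B F)
    (hR : 9 / 2 ≤ ϱ) (hRρ : R' + ρ ≤ ϱ) (hρ : ρ ≤ ϱ) (hR' : R' ≤ ϱ) (hD : 13 / 10 * D + 1 ≤ ϱ) (hC : 0 ≤ C)
    (he : -(7175 / 10000 : ℝ) < e₁)
    (h : PairRuleMotifCertificateX (1 / 20) η₁ (effPot w₄₅ ω₄ (3 / 400)) (3 / 400) e₁ (-C) 0 (-C) D ϱ F ExM) :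
    Summit.AtomisticToContinuum.Crystallization.Theses.FrustratedLawDichotomy.AperiodicFrustratedLawGap :=
  aperiodicFrustratedLawGap_of_schurCutX_fourHalf hDoor hF hU hExDeep
    (schurRangeGapX_fourHalf_of_motifX hF₁ hF₂ hF₃ hR hRρ hρ hR' hD hC hEx h) he

end Summit.AtomisticToContinuum.Crystallization.Theorems.FrustratedLawDichotomyPairPotentialDoorX

end
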